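import Literature.MathematicalPhysics.KineticTheory.DiPernaLionsMildLimitProofs
import HarnessLib

/-!
# Entropy dissipation and the control of the gain by the loss term (CIP (3.27), (3.49))

Topic: MathematicalPhysics / KineticTheory. First layer of the proof of the named fact (E49)
`Kinetic.diPernaLions_limit_gain_le_loss` of
`Literature.MathematicalPhysics.KineticTheory.DiPernaLionsMildLimit` (Cercignani–Illner–Pulvirenti
1994 §5.3 Step 14, (3.46)–(3.49), pp. 159–160: `Q±(f,f) ≤ 2 Q∓(f,f) + E`, `E ∈ L¹((0,T) × E × E)`,
for the DiPerna–Lions weak limit `f`): the reduction of (3.49) to the finiteness of the entropy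
dissipation of the density, everything proved.

* **(3.27)/(3.29) pointwise** (CIP 1994 §5.3 Step 9, end of the proof of Lemma 5.3.7): for every
  `K > 1`,
  `Q₊ ≤ K Q₋ + (ln K)⁻¹ ∫∫ B (f'f'_* - f f_*) ln (f'f'_*/(f f_*))` and symmetrically, because on
  `{f'f'_* ≥ K f f_*}` one has `ln (f'f'_*/(f f_*)) ≥ ln K`. This is an inequality between integrals
  of nonnegative functions and holds for *every* density, pointwise in `(t, x, v)`, once the
  dissipation integrand `j(a, b) = (a - b) ln (a/b)` is given its lower semicontinuous value `+∞` at
  the boundary points `(a, 0)`, `(0, b)` (`a, b > 0`) of the quadrant (`Kinetic.dissipationFun`,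
  `Kinetic.eDissipation`; `eGain_le_mul_eLoss_add_eDissipation`,
  `eLoss_le_mul_eGain_add_eDissipation`, for the true collision integrals `Kinetic.eGain`,
  `Kinetic.eLoss` of `DiPernaLionsMildLimitProofs`).
* **(3.49) from finite dissipation** (`exists_gain_le_loss_of_lintegral_eDissipation_lt_top`): if
  `∫_{(0,T) × E × E} D(f) < ∞` then `E_T = (ln 2)⁻¹ D(f)` is an admissible error term:
  nonnegative, measurable, of finite integral on the slab, with `Q± ≤ 2 Q∓ + E_T` a.e. there.

What remains for (E49) is the entropy-dissipation bound for the weak limit — CIP 1994 Step 14,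
last paragraph p. 160 ("`∫₀ᵀ ∫∫ e(f)/(1 + δ∫f dξ) ≤ liminf_n ∫₀ᵀ ∫∫ eₙ(fⁿ)/(1 + δ∫fⁿ dξ)` ... by the
convexity of `(x, y) → (x - y) ln (x/y)`", from the weak limits
`fⁿfⁿ_*/(1 + δ∫fⁿ dξ) ⇀ f f_*/(1 + δ∫f dξ)` obtained by velocity averaging), i.e. the dissipation
term of the entropy inequality (E) of DiPerna–Lions 1991 / Lions 1993 Thm III.4 — together with the
uniform bound (3.23) (`UniformDiPernaLionsBounds.dissipation_le`); it is proved in sibling files.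
CIP themselves derive (3.49) from (3.46)–(3.48), the weak `L¹` limits of the normalised collision
terms of Lemma 5.3.11 (iii), printed under Gérard's simplifying assumption (3.13) `A ∈ L^∞_loc`,
which the tree's statements (DiPerna–Lions' generality) do not make; the route through the
dissipation of the limit needs velocity averaging only in the kernel-free form of Lemma 5.3.11 (i)
/ Lions 1993 (47).

## Definitions

* `Kinetic.dissipationFun a b ∈ [0, ∞]`: `(a - b) log (a/b)` for `a, b > 0`, `0` at `(0, 0)`, `+∞`
  when exactly one argument is positive (nonpositive arguments count as `0`): the lower
  semicontinuous convex extension to the closed quadrant; symmetric (`dissipationFun_comm`),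
  measurable (`measurable_dissipationFun`).
* `Kinetic.eDissipation B f (t, x, v) = ∫∫ B(v, v_*, ω) j(f(v') f(v_*'), f(v) f(v_*)) dω dv_* ∈ [0,∞]`:
  the entropy-dissipation density of a phase-space density per unit `(t, x, v)`; for a positive
  density its integrand is `ENNReal.ofReal` of `Kinetic.entropyProductionIntegrand`
  (`ofReal_mul_dissipationFun_eq`), so that `∫ eDissipation dv = 4 ∫ e(f) dξ` in the notation of
  CIP (3.7)/(3.24) (`Kinetic.eEntropyProduction` carries the factor `¼`).

## References

* C. Cercignani, R. Illner, M. Pulvirenti, *The Mathematical Theory of Dilute Gases*, Springer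
  (1994), §5.3: Lemma 5.3.1 (3.7)–(3.9) (pp. 141–142), Step 7 (3.21)–(3.24) (p. 147), Step 9, end
  of the proof of Lemma 5.3.7, (3.27)–(3.29), Step 14 (3.46)–(3.49) and last paragraph
  (pp. 159–160).
* P.-L. Lions, *Global solutions of kinetic models and related problems*, in: Nonequilibrium
  Problems in Many-Particle Systems, LNM 1551 (1993), (E) p. 54 and Thm III.4 p. 57.
* R. J. DiPerna, P.-L. Lions, *Global solutions of Boltzmann's equation and the entropy
  inequality*, Arch. Rational Mech. Anal. 114 (1991) 47–55.
-/

open MeasureTheory Metric Real Set Filter Topology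
open scoped InnerProductSpace ENNReal

noncomputable section

namespace Literature.MathematicalPhysics.KineticTheory

/-! ## The entropy-dissipation function `(a - b) log (a / b)` on the closed quadrant -/

/-- The entropy-dissipation function of Boltzmann's H-theorem,
`j(a, b) = (a - b) log (a / b) ∈ [0, ∞]`, extended from the open quadrant `a, b > 0` to the closed
one as a lower semicontinuous convex function: `j(0, 0) = 0` and `j(a, 0) = j(0, b) = +∞` for
`a, b > 0` (nonpositive arguments are treated as `0`). (CIP 1994 §3.2 and §5.3 (3.7):
`e(f) = ¼ ∫∫ (f'f'_* - f f_*) ln (f'f'_*/(f f_*)) q dξ_* dn`; Step 14 p. 160: "the convexity of the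
function `(x, y) → (x - y) ln (x/y)` on `ℝ₊ × ℝ₊`".) [cite: CIPDiluteGases1994, §5.3 (3.7) and Step 14 (p. 160)] -/
def dissipationFun (a b : ℝ) : ℝ≥0∞ :=
  if 0 < a ∧ 0 < b then ENNReal.ofReal ((a - b) * log (a / b))
  else if a ≤ 0 ∧ b ≤ 0 then 0 else ∞

/-- On the open quadrant, `j(a, b) = (a - b) log (a / b)`. [folklore] -/
theorem dissipationFun_of_pos {a b : ℝ} (ha : 0 < a) (hb : 0 < b) :
    dissipationFun a b = ENNReal.ofReal ((a - b) * log (a / b)) := by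
  simp [dissipationFun, ha, hb]

/-- `j(a, b) = 0` when both arguments are nonpositive. [folklore] -/
theorem dissipationFun_of_nonpos {a b : ℝ} (ha : a ≤ 0) (hb : b ≤ 0) : dissipationFun a b = 0 := by
  simp [dissipationFun, ha, hb, not_lt.2 ha]

/-- `j(0, 0) = 0`. [folklore] -/
@[simp]
theorem dissipationFun_zero_zero : dissipationFun 0 0 = 0 :=
  dissipationFun_of_nonpos le_rfl le_rfl

/-- `j(a, b) = +∞` when `a > 0 ≥ b`. [folklore] -/
theorem dissipationFun_of_pos_of_nonpos {a b : ℝ} (ha : 0 < a) (hb : b ≤ 0) :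
    dissipationFun a b = ∞ := by
  simp [dissipationFun, not_lt.2 hb, not_le.2 ha]

/-- `j(a, b) = +∞` when `b > 0 ≥ a`. [folklore] -/
theorem dissipationFun_of_nonpos_of_pos {a b : ℝ} (ha : a ≤ 0) (hb : 0 < b) :
    dissipationFun a b = ∞ := by
  simp [dissipationFun, not_lt.2 ha, not_le.2 hb]

/-- The real dissipation integrand is symmetric: `(a - b) log (a/b) = (b - a) log (b/a)` for
`a, b > 0`. [folklore] -/
theorem sub_mul_log_div_comm {a b : ℝ} (ha : 0 < a) (hb : 0 < b) :
    (a - b) * log (a / b) = (b - a) * log (b / a) := by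
  rw [log_div ha.ne' hb.ne', log_div hb.ne' ha.ne']
  ring

/-- The real dissipation integrand is nonnegative on the open quadrant (Boltzmann's inequality).
[folklore] -/
theorem sub_mul_log_div_nonneg {a b : ℝ} (ha : 0 < a) (hb : 0 < b) :
    0 ≤ (a - b) * log (a / b) := by
  rcases le_total b a with hab | hab
  · exact mul_nonneg (sub_nonneg.2 hab) (log_nonneg ((one_le_div hb).2 hab))
  · exact mul_nonneg_of_nonpos_of_nonpos (sub_nonpos.2 hab)
      (log_nonpos (div_pos ha hb).le ((div_le_one hb).2 hab))

/-- `j` is symmetric. [folklore] -/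
theorem dissipationFun_comm (a b : ℝ) : dissipationFun a b = dissipationFun b a := by
  rcases lt_or_ge 0 a with ha | ha <;> rcases lt_or_ge 0 b with hb | hb
  · rw [dissipationFun_of_pos ha hb, dissipationFun_of_pos hb ha, sub_mul_log_div_comm ha hb]
  · rw [dissipationFun_of_pos_of_nonpos ha hb, dissipationFun_of_nonpos_of_pos hb ha]
  · rw [dissipationFun_of_nonpos_of_pos ha hb, dissipationFun_of_pos_of_nonpos hb ha]
  · rw [dissipationFun_of_nonpos ha hb, dissipationFun_of_nonpos hb ha]

/-- `j` is jointly measurable. [folklore] -/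
theorem measurable_dissipationFun : Measurable fun p : ℝ × ℝ => dissipationFun p.1 p.2 := by
  unfold dissipationFun
  refine Measurable.ite ?_ ?_ (Measurable.ite ?_ measurable_const measurable_const)
  · exact (measurableSet_lt measurable_const measurable_fst).inter
      (measurableSet_lt measurable_const measurable_snd)
  · exact ((measurable_fst.sub measurable_snd).mul
      (measurable_log.comp (measurable_fst.div measurable_snd))).ennreal_ofReal
  · exact (measurableSet_le measurable_fst measurable_const).inter
      (measurableSet_le measurable_snd measurable_const)

/-- **The pointwise inequality behind CIP (3.27)/(3.29)**: for `K > 1` and reals `a, b`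
(nonpositive values counting as `0`), `a ≤ K b + (ln K)⁻¹ (a - b) ln (a/b)` in `[0, ∞]`: if
`a > K b > 0` then `ln (a/b) ≥ ln K`, so `(ln K)⁻¹ (a - b) ln (a/b) ≥ a - b ≥ a - K b` (CIP 1994
Step 9: "On `A_Kⁿ`, `ln (fⁿ'fⁿ_*'/(fⁿfⁿ_*)) ≥ ln K`, and (3.27) follows easily"). [cite: CIPDiluteGases1994, §5.3 Step 9, proof of Lemma 5.3.7, (3.27)] -/
theorem ofReal_le_mul_ofReal_add_dissipationFun {K : ℝ} (hK : 1 < K) (a b : ℝ) :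
    ENNReal.ofReal a ≤ ENNReal.ofReal K * ENNReal.ofReal b +
      ENNReal.ofReal (log K)⁻¹ * dissipationFun a b := by
  have hlogK : 0 < log K := log_pos hK
  rcases le_or_gt a 0 with ha | ha
  · simp [ENNReal.ofReal_of_nonpos ha]
  rcases le_or_gt b 0 with hb | hb
  · rw [dissipationFun_of_pos_of_nonpos ha hb, ENNReal.mul_top (by simp [hlogK])]
    simp
  rw [dissipationFun_of_pos ha hb, ← ENNReal.ofReal_mul (by linarith),
    ← ENNReal.ofReal_mul (inv_pos.2 hlogK).le,
    ← ENNReal.ofReal_add (by nlinarith) (mul_nonneg (inv_pos.2 hlogK).le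
      (sub_mul_log_div_nonneg ha hb))]
  refine ENNReal.ofReal_le_ofReal ?_
  by_cases hab : a ≤ K * b
  · nlinarith [mul_nonneg (inv_pos.2 hlogK).le (sub_mul_log_div_nonneg ha hb)]
  · rw [not_le] at hab
    have hKb : b < a := by nlinarith
    have hlog : log K ≤ log (a / b) :=
      log_le_log (by linarith) ((lt_div_iff₀ hb).2 hab).le
    have h1 : (a - b) * log K ≤ (a - b) * log (a / b) :=
      mul_le_mul_of_nonneg_left hlog (sub_nonneg.2 hKb.le)
    have h2 : (log K)⁻¹ * ((a - b) * log (a / b)) ≥ a - b := by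
      rw [ge_iff_le, ← div_le_iff₀' (inv_pos.2 hlogK), div_inv_eq_mul]
      linarith
    nlinarith

/-- The case `K = 2`: `a ≤ 2 b + (ln 2)⁻¹ (a - b) ln (a/b)` in `[0, ∞]`. [folklore] -/
theorem ofReal_le_two_mul_ofReal_add_dissipationFun (a b : ℝ) :
    ENNReal.ofReal a ≤ 2 * ENNReal.ofReal b + ENNReal.ofReal (log 2)⁻¹ * dissipationFun a b := by
  have := ofReal_le_mul_ofReal_add_dissipationFun one_lt_two a b
  simpa only [ENNReal.ofReal_ofNat] using this

/-! ## The entropy-dissipation density of a phase-space density -/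

section Dissipation

variable {E : Type*} [NormedAddCommGroup E] [InnerProductSpace ℝ E] [FiniteDimensional ℝ E]
  [MeasurableSpace E] [BorelSpace E] {B : E × E → sphere (0 : E) 1 → ℝ}

/-- The entropy-dissipation density
`D(f)(t, x, v) = ∫∫ B(v, v_*, ω) j(f(v') f(v_*'), f(v) f(v_*)) dω dv_* ∈ [0, ∞]` of a phase-space
density at `p = (t, x, v)`, `j(a, b) = (a - b) ln (a/b)` with its lower semicontinuous convention
(`dissipationFun`); `¼ D(f)` is CIP's `e(f)(x, ξ, t)` of (3.7), and `∫ D dω` summed over `v_*` is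
Lions' `D` of (E) (CIP 1994 §5.3 Lemma 5.3.1 (3.7); Lions 1993 p. 54). [cite: CIPDiluteGases1994, §5.3 Lemma 5.3.1 (3.7)]
[cite: Lions1993Kinetic, (E) (p. 54)] -/
def eDissipation (B : E × E → sphere (0 : E) 1 → ℝ) (f : ℝ → E → E → ℝ) (p : ℝ × E × E) : ℝ≥0∞ :=
  ∫⁻ q : E × sphere (0 : E) 1, ENNReal.ofReal (B (p.2.2, q.1) q.2) *
    dissipationFun
      (f p.1 p.2.1 (KineticTheory.collide q.2 (p.2.2, q.1)).1 *
        f p.1 p.2.1 (KineticTheory.collide q.2 (p.2.2, q.1)).2)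
      (f p.1 p.2.1 p.2.2 * f p.1 p.2.1 q.1) ∂(volume.prod KineticTheory.sphereMeasure)

omit [FiniteDimensional ℝ E] [MeasurableSpace E] [BorelSpace E] in
/-- For a positive density and a nonnegative kernel, the integrand of `eDissipation` is
`ENNReal.ofReal` of the tree's `Kinetic.entropyProductionIntegrand` at `((v, v_*), ω)`. [folklore] -/
theorem ofReal_mul_dissipationFun_eq (hB0 : ∀ p ω, 0 ≤ B p ω) {h : E → ℝ} (hpos : ∀ v, 0 < h v)
    (q : (E × E) × sphere (0 : E) 1) :
    ENNReal.ofReal (B q.1 q.2) *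
        dissipationFun (h (KineticTheory.collide q.2 q.1).1 * h (KineticTheory.collide q.2 q.1).2)
          (h q.1.1 * h q.1.2) =
      ENNReal.ofReal (entropyProductionIntegrand B h q) := by
  rw [dissipationFun_of_pos (mul_pos (hpos _) (hpos _)) (mul_pos (hpos _) (hpos _)),
    entropyProductionIntegrand, ENNReal.ofReal_mul (hB0 _ _)]

/-- Joint measurability of the post-collisional product `f(v') f(v_*')` in `((t,x,v), (v_*, ω))`.
[folklore] -/
theorem measurable_gainProduct_param {f : ℝ → E → E → ℝ}
    (hfm : Measurable fun z : ℝ × E × E => f z.1 z.2.1 z.2.2) :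
    Measurable fun y : (ℝ × E × E) × (E × sphere (0 : E) 1) =>
      f y.1.1 y.1.2.1 (KineticTheory.collide y.2.2 (y.1.2.2, y.2.1)).1 *
        f y.1.1 y.1.2.1 (KineticTheory.collide y.2.2 (y.1.2.2, y.2.1)).2 := by
  have hr : Measurable fun y : (ℝ × E × E) × (E × sphere (0 : E) 1) =>
      ((y.1.2.2, y.2.1), y.2.2) :=
    ((measurable_fst.snd.snd).prodMk measurable_snd.fst).prodMk measurable_snd.snd
  have hc : Measurable fun y : (ℝ × E × E) × (E × sphere (0 : E) 1) =>
      KineticTheory.collide y.2.2 (y.1.2.2, y.2.1) :=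
    Literature.Analysis.FluidPDE.continuous_collide_uncurry.measurable.comp hr
  have ht : Measurable fun y : (ℝ × E × E) × (E × sphere (0 : E) 1) => y.1.1 := measurable_fst.fst
  have hx : Measurable fun y : (ℝ × E × E) × (E × sphere (0 : E) 1) => y.1.2.1 :=
    measurable_fst.snd.fst
  exact (hfm.comp (ht.prodMk (hx.prodMk hc.fst))).mul (hfm.comp (ht.prodMk (hx.prodMk hc.snd)))

omit [InnerProductSpace ℝ E] [FiniteDimensional ℝ E] [BorelSpace E] in
/-- Joint measurability of the pre-collisional product `f(v) f(v_*)` in `((t,x,v), (v_*, ω))`.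
[folklore] -/
theorem measurable_lossProduct_param {f : ℝ → E → E → ℝ}
    (hfm : Measurable fun z : ℝ × E × E => f z.1 z.2.1 z.2.2) :
    Measurable fun y : (ℝ × E × E) × (E × sphere (0 : E) 1) =>
      f y.1.1 y.1.2.1 y.1.2.2 * f y.1.1 y.1.2.1 y.2.1 := by
  have ht : Measurable fun y : (ℝ × E × E) × (E × sphere (0 : E) 1) => y.1.1 := measurable_fst.fst
  have hx : Measurable fun y : (ℝ × E × E) × (E × sphere (0 : E) 1) => y.1.2.1 :=
    measurable_fst.snd.fst
  exact (hfm.comp measurable_fst).mul (hfm.comp (ht.prodMk (hx.prodMk measurable_snd.fst)))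

/-- Joint measurability of the dissipation integrand in `((t,x,v), (v_*, ω))`. [folklore] -/
theorem measurable_dissipationIntegrand_param (hBm : Measurable (Function.uncurry B))
    {f : ℝ → E → E → ℝ} (hfm : Measurable fun z : ℝ × E × E => f z.1 z.2.1 z.2.2) :
    Measurable fun y : (ℝ × E × E) × (E × sphere (0 : E) 1) =>
      ENNReal.ofReal (B (y.1.2.2, y.2.1) y.2.2) *
        dissipationFun
          (f y.1.1 y.1.2.1 (KineticTheory.collide y.2.2 (y.1.2.2, y.2.1)).1 *
            f y.1.1 y.1.2.1 (KineticTheory.collide y.2.2 (y.1.2.2, y.2.1)).2)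
          (f y.1.1 y.1.2.1 y.1.2.2 * f y.1.1 y.1.2.1 y.2.1) := by
  have hr : Measurable fun y : (ℝ × E × E) × (E × sphere (0 : E) 1) =>
      ((y.1.2.2, y.2.1), y.2.2) :=
    ((measurable_fst.snd.snd).prodMk measurable_snd.fst).prodMk measurable_snd.snd
  exact (hBm.comp hr).ennreal_ofReal.mul (measurable_dissipationFun.comp
    ((measurable_gainProduct_param hfm).prodMk (measurable_lossProduct_param hfm)))

/-- `eDissipation` is measurable in `(t, x, v)`. [folklore] -/
theorem measurable_eDissipation (hBm : Measurable (Function.uncurry B)) {f : ℝ → E → E → ℝ}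
    (hfm : Measurable fun z : ℝ × E × E => f z.1 z.2.1 z.2.2) : Measurable (eDissipation B f) := by
  haveI := Literature.Analysis.FluidPDE.isFiniteMeasure_sphereMeasure (E := E)
  exact (measurable_dissipationIntegrand_param hBm hfm).lintegral_prod_right'

/-- **CIP (3.27) for an arbitrary nonnegative density, true collision integrals**: for `K > 1`,
`Q₊(f,f) ≤ K Q₋(f,f) + (ln K)⁻¹ D(f)` pointwise in `(t, x, v)`, for the `[0,∞]`-valued gain, loss
and dissipation integrals (CIP 1994 §5.3 Step 9, (3.27): "`Q₊ⁿ ≤ K Q₋ⁿ + (1/ln K) eₙ`", there for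
the approximate solutions; the proof is pointwise in the integration variables). [cite: CIPDiluteGases1994, §5.3 Step 9, proof of Lemma 5.3.7, (3.27)] -/
theorem eGain_le_mul_eLoss_add_eDissipation (hBm : Measurable (Function.uncurry B))
    (hB0 : ∀ p ω, 0 ≤ B p ω) {f : ℝ → E → E → ℝ}
    (hfm : Measurable fun z : ℝ × E × E => f z.1 z.2.1 z.2.2) {K : ℝ} (hK : 1 < K)
    (p : ℝ × E × E) :
    eGain B f p ≤ ENNReal.ofReal K * eLoss B f p + ENNReal.ofReal (log K)⁻¹ * eDissipation B f p := by
  have hmeas : Measurable fun q : E × sphere (0 : E) 1 => ENNReal.ofReal K *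
      ENNReal.ofReal (B (p.2.2, q.1) q.2 * (f p.1 p.2.1 p.2.2 * f p.1 p.2.1 q.1)) :=
    ((measurable_lossIntegrand_param hBm hfm).comp
      (measurable_prodMk_left (x := p))).ennreal_ofReal.const_mul _
  calc eGain B f p
      ≤ ∫⁻ q : E × sphere (0 : E) 1, (ENNReal.ofReal K *
          ENNReal.ofReal (B (p.2.2, q.1) q.2 * (f p.1 p.2.1 p.2.2 * f p.1 p.2.1 q.1)) +
          ENNReal.ofReal (log K)⁻¹ * (ENNReal.ofReal (B (p.2.2, q.1) q.2) *
            dissipationFun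
              (f p.1 p.2.1 (KineticTheory.collide q.2 (p.2.2, q.1)).1 *
                f p.1 p.2.1 (KineticTheory.collide q.2 (p.2.2, q.1)).2)
              (f p.1 p.2.1 p.2.2 * f p.1 p.2.1 q.1)))
          ∂(volume.prod KineticTheory.sphereMeasure) := by
        refine lintegral_mono fun q => ?_
        rw [ENNReal.ofReal_mul (hB0 _ _), ENNReal.ofReal_mul (hB0 _ _)]
        calc ENNReal.ofReal (B (p.2.2, q.1) q.2) *
              ENNReal.ofReal (f p.1 p.2.1 (KineticTheory.collide q.2 (p.2.2, q.1)).1 *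
                f p.1 p.2.1 (KineticTheory.collide q.2 (p.2.2, q.1)).2)
            ≤ ENNReal.ofReal (B (p.2.2, q.1) q.2) * (ENNReal.ofReal K *
                ENNReal.ofReal (f p.1 p.2.1 p.2.2 * f p.1 p.2.1 q.1) +
                ENNReal.ofReal (log K)⁻¹ * dissipationFun
                  (f p.1 p.2.1 (KineticTheory.collide q.2 (p.2.2, q.1)).1 *
                    f p.1 p.2.1 (KineticTheory.collide q.2 (p.2.2, q.1)).2)
                  (f p.1 p.2.1 p.2.2 * f p.1 p.2.1 q.1)) :=
              by gcongr; exact ofReal_le_mul_ofReal_add_dissipationFun hK _ _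
          _ = _ := by ring
    _ = ENNReal.ofReal K * eLoss B f p + ENNReal.ofReal (log K)⁻¹ * eDissipation B f p := by
        rw [lintegral_add_left hmeas, lintegral_const_mul' _ _ ENNReal.ofReal_ne_top,
          lintegral_const_mul' _ _ ENNReal.ofReal_ne_top]
        rfl

/-- **CIP (3.29) for an arbitrary nonnegative density, true collision integrals**: for `K > 1`,
`Q₋(f,f) ≤ K Q₊(f,f) + (ln K)⁻¹ D(f)` pointwise in `(t, x, v)` (CIP 1994 §5.3 Step 9, Remark (3.29):
"In the same way, one proves that `Q₋ⁿ ≤ K Q₊ⁿ + (4/ln K) eₙ`"; here by the symmetry of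
`(a - b) ln (a/b)`). [cite: CIPDiluteGases1994, §5.3 Step 9, Remark after Lemma 5.3.7, (3.29)] -/
theorem eLoss_le_mul_eGain_add_eDissipation (hBm : Measurable (Function.uncurry B))
    (hB0 : ∀ p ω, 0 ≤ B p ω) {f : ℝ → E → E → ℝ}
    (hfm : Measurable fun z : ℝ × E × E => f z.1 z.2.1 z.2.2) {K : ℝ} (hK : 1 < K)
    (p : ℝ × E × E) :
    eLoss B f p ≤ ENNReal.ofReal K * eGain B f p + ENNReal.ofReal (log K)⁻¹ * eDissipation B f p := by
  have hmeas : Measurable fun q : E × sphere (0 : E) 1 => ENNReal.ofReal K *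
      ENNReal.ofReal (B (p.2.2, q.1) q.2 *
        (f p.1 p.2.1 (KineticTheory.collide q.2 (p.2.2, q.1)).1 *
          f p.1 p.2.1 (KineticTheory.collide q.2 (p.2.2, q.1)).2)) :=
    ((measurable_gainIntegrand_param hBm hfm).comp
      (measurable_prodMk_left (x := p))).ennreal_ofReal.const_mul _
  calc eLoss B f p
      ≤ ∫⁻ q : E × sphere (0 : E) 1, (ENNReal.ofReal K *
          ENNReal.ofReal (B (p.2.2, q.1) q.2 *
            (f p.1 p.2.1 (KineticTheory.collide q.2 (p.2.2, q.1)).1 *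
              f p.1 p.2.1 (KineticTheory.collide q.2 (p.2.2, q.1)).2)) +
          ENNReal.ofReal (log K)⁻¹ * (ENNReal.ofReal (B (p.2.2, q.1) q.2) *
            dissipationFun
              (f p.1 p.2.1 (KineticTheory.collide q.2 (p.2.2, q.1)).1 *
                f p.1 p.2.1 (KineticTheory.collide q.2 (p.2.2, q.1)).2)
              (f p.1 p.2.1 p.2.2 * f p.1 p.2.1 q.1)))
          ∂(volume.prod KineticTheory.sphereMeasure) := by
        refine lintegral_mono fun q => ?_
        rw [ENNReal.ofReal_mul (hB0 _ _), ENNReal.ofReal_mul (hB0 _ _), dissipationFun_comm]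
        calc ENNReal.ofReal (B (p.2.2, q.1) q.2) * ENNReal.ofReal (f p.1 p.2.1 p.2.2 * f p.1 p.2.1 q.1)
            ≤ ENNReal.ofReal (B (p.2.2, q.1) q.2) * (ENNReal.ofReal K *
                ENNReal.ofReal (f p.1 p.2.1 (KineticTheory.collide q.2 (p.2.2, q.1)).1 *
                  f p.1 p.2.1 (KineticTheory.collide q.2 (p.2.2, q.1)).2) +
                ENNReal.ofReal (log K)⁻¹ * dissipationFun (f p.1 p.2.1 p.2.2 * f p.1 p.2.1 q.1)
                  (f p.1 p.2.1 (KineticTheory.collide q.2 (p.2.2, q.1)).1 *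
                    f p.1 p.2.1 (KineticTheory.collide q.2 (p.2.2, q.1)).2)) :=
              by gcongr; exact ofReal_le_mul_ofReal_add_dissipationFun hK _ _
          _ = _ := by ring
    _ = ENNReal.ofReal K * eGain B f p + ENNReal.ofReal (log K)⁻¹ * eDissipation B f p := by
        rw [lintegral_add_left hmeas, lintegral_const_mul' _ _ ENNReal.ofReal_ne_top,
          lintegral_const_mul' _ _ ENNReal.ofReal_ne_top]
        rfl

/-! ## (3.49) for a density with finite entropy dissipation -/

/-- **`Q± ≤ 2 Q∓ + E` from finite entropy dissipation** (CIP 1994 §5.3 Step 14, (3.49) p. 160: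
"`Q±(f,f) ≤ 2Q∓(f,f) + E` with `E ∈ L¹((0,T) × ℝ^d × ℝ^d)`", here in the form in which it follows
from (3.27)/(3.29) with `K = 2` and the entropy-dissipation bound: for a measurable kernel `B ≥ 0`
and a jointly measurable density `f` whose entropy dissipation `∫_{(0,T) × E × E} D(f)` is finite,
`E_T = (ln 2)⁻¹ D(f)` is nonnegative, measurable, has finite integral over `(0,T) × E × E`, and
`Q₊(f,f) ≤ 2 Q₋(f,f) + E_T`, `Q₋(f,f) ≤ 2 Q₊(f,f) + E_T` hold almost everywhere on the slab for the
true collision integrals `eGain`, `eLoss`). [cite: CIPDiluteGases1994, §5.3 Step 14 (3.49) (p. 160)] -/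
theorem exists_gain_le_loss_of_lintegral_eDissipation_lt_top (hBm : Measurable (Function.uncurry B))
    (hB0 : ∀ p ω, 0 ≤ B p ω) {f : ℝ → E → E → ℝ}
    (hfm : Measurable fun z : ℝ × E × E => f z.1 z.2.1 z.2.2) {T : ℝ}
    (hfin : ∫⁻ z in Ioo 0 T ×ˢ univ, eDissipation B f z ∂(volume : Measure (ℝ × E × E)) < ∞) :
    ∃ Er : ℝ × E × E → ℝ, (∀ z, 0 ≤ Er z) ∧ Measurable Er ∧
      (∫⁻ z in Ioo 0 T ×ˢ univ, ENNReal.ofReal (Er z) ∂(volume : Measure (ℝ × E × E)) < ∞) ∧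
      ∀ᵐ z : ℝ × E × E ∂(volume.restrict (Ioo 0 T ×ˢ univ)),
        eGain B f z ≤ 2 * eLoss B f z + ENNReal.ofReal (Er z) ∧
          eLoss B f z ≤ 2 * eGain B f z + ENNReal.ofReal (Er z) := by
  have hDm : Measurable (eDissipation B f) := measurable_eDissipation hBm hfm
  set c : ℝ≥0∞ := ENNReal.ofReal (log 2)⁻¹
  have hcm : Measurable fun z => c * eDissipation B f z := hDm.const_mul c
  have hfin' :
      ∫⁻ z in Ioo 0 T ×ˢ univ, c * eDissipation B f z ∂(volume : Measure (ℝ × E × E)) < ∞ := by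
    rw [lintegral_const_mul' _ _ ENNReal.ofReal_ne_top]
    exact ENNReal.mul_lt_top ENNReal.ofReal_lt_top hfin
  refine ⟨fun z => (c * eDissipation B f z).toReal, fun z => ENNReal.toReal_nonneg,
    hcm.ennreal_toReal, ?_, ?_⟩
  · exact lt_of_le_of_lt (lintegral_mono fun z => ENNReal.ofReal_toReal_le) hfin'
  · have hlt : ∀ᵐ z : ℝ × E × E ∂(volume.restrict (Ioo 0 T ×ˢ univ)),
        c * eDissipation B f z < ∞ := ae_lt_top hcm hfin'.ne
    filter_upwards [hlt] with z hz
    rw [ENNReal.ofReal_toReal hz.ne]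
    have h1 := eGain_le_mul_eLoss_add_eDissipation hBm hB0 hfm one_lt_two z
    have h2 := eLoss_le_mul_eGain_add_eDissipation hBm hB0 hfm one_lt_two z
    simp only [ENNReal.ofReal_ofNat] at h1 h2
    exact ⟨h1, h2⟩

end Dissipation

end Literature.MathematicalPhysics.KineticTheory
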